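/-
Copyright (c) 2026. All rights reserved.
Released under Apache 2.0 license as described in the file LICENSE.
-/
import Literature.Probability.FitznerVanDerHofstad2017.NobleBlocksNTPrime
import Literature.Probability.FitznerVanDerHofstad2017.NobleBoundsNAssemblyStarAvg
import HarnessLib

/-!
# Fitzner–van der Hofstad (2017), §5.1 (5.4): the PRIMED middle block, pointwise and summed

[FvdH17] = R. Fitzner, R. van der Hofstad, *Generalized approach to the non-backtracking lace expansion* /
*Mean-field behavior for nearest-neighbor percolation in `d > 10`*, arXiv:1506.07977v2 (EJP 22 (2017),
paper 43).  Page numbers refer to the arXiv version.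

The middle block `B^{ι,a,b}` of (5.4) (p. 48) in the §6.1 READING of its row `(0,0)` letters (the primed families
`A'^{ι,a,c,*}`, `A'^{ι,a,b}` of `NobleBlocksPrime`, DIVERGENCE D74 (i) of the b2b-lace packet: the landed class
packages at entry class `0` bound by `T_{1̲,1,1}(e,x,0)`, not by the App. B row `T_{1,1̲,1}(e,x,0)`), with the
double non-trivial triangle read at base `u` (`NobleBlocksNTPrime.blockBNTpt'`, D76) and with an EXTRA-SUMMAND
slot `X` (`:= 0` unless the packet's referee question D77 is ruled payable, in which case it receives the
term `2′` of `A♯`; nothing about D77 is decided here):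

* §A. `blockB'  L B2 X₂` / `blockBpt' L B2pt X` — (5.4) summed / pointwise in the internal pair, primed letters,
  parameters `B2`/`B2pt` (the `B^{(2)}` piece) and `X₂`/`X` (extra summand); `blockBFull' L X₂ := blockB' L
  (blockBNT' L) X₂`, `blockBFullpt' L X := blockBpt' L (blockBNTpt' L) X`; the matrix `matBiotaFull' L X₂`.
* §B. Algebra: off entry class `0` the primed block is the landed one plus `X` (`blockBpt'_of_ne`,
  `blockB'_of_ne`); `Σ_{t,z} blockBpt' = blockB'` (`tsum_tsum_blockBpt'`, `tsum_tsum_blockBFullpt'`,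
  `blockBFullpt'_hBpt`), and the `X = 0` specialisations.
* §C. Translation invariance in all six / four vertices (`isTransInv₆_blockBNTpt'`, `isTransInv₆_blockBpt'`,
  `isTransInv₆_blockBFullpt'`, `isTransInv_blockB'`, `isTransInv_blockBFull'`).
* §D. Bond percolation: `W_d`-covariance (`perc_blockBNTpt₀'_signedPerm`, `perc_blockBNTpt'_signedPerm`,
  `perc_blockBpt'_signedPerm`, `perc_blockBFullpt'_signedPerm`, `sum_perc_blockBFullpt'_signedPerm`,
  `isCov₆_sum_perc_blockBFullpt'`) — the hypotheses `hBpt` of `NobleBoundsNAssemblyStarAvg.isCov₃_sum_secEc` /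
  `isCov₄_sum_secEo` / `isCov₃_sum_secEoc` for the primed block.

Additive: nothing in `NobleBlocksPointwise` / `NobleBlocksNT` / `NobleBoundsNAssemblyStar[Avg]` is touched;
`d`-generic; nothing is cited as a fact.
-/

noncomputable section

open scoped ENNReal

namespace Literature.Probability.FitznerVanDerHofstad2017.NobleBlocks

open Literature.Probability.LatticeModels Literature.Probability.Percolation
open Literature.Probability.FitznerVanDerHofstad2017.BlockSummation
open Literature.Barriers.CriticalPhenomena (signedPerm_sub signedPerm_neg)
open scoped BigOperators ENNReal

variable {d : ℕ}

local notation "𝐞" => Literature.Probability.Percolation.stepVec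

/-! ### A. Definitions -/

/-- **`B'^{ι,a,b}` — (5.4) with the primed `A`-letters and an extra summand**:
`B'^{ι,a,b}(u,v,x,y) = Σ_{w,t} Σ_c A'^{ι,a,c,*}(u,v,w,t) A^{c,b}(w,t,x,y) + Σ_t A'^{ι,a,b}(u,v,x,t) P^{0}(y−t,y−t)
+ B2^{ι,a,b}(u,v,x,y) + X₂^{ι,a,b}(u,v,x,y)`.
[cite: FitznerVanDerHofstad2017, §5.1 (5.4) (arXiv:1506.07977v2 p. 48); §6.1 "Case a = 0 and b = 0" (p. 59)] -/
def blockB' (L : Letters d) (B2 X₂ : DirBlockFamily d) : DirBlockFamily d := fun ι a b u v x y =>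
  (∑ c : Fin 3, comp (blockAiotaSt' L ι a c) (blockA L c b) u v x y)
    + (∑' t, blockAiota' L ι a b u v x t * blockPS L 0 (y - t) (y - t))
    + B2 ι a b u v x y + X₂ ι a b u v x y

/-- **`B'^{ι,a,b}` pointwise in the internal pair `(t,z)`** (slot order of `blockBpt`):
`Σ_c A'^{κ,a,c,*}(u,w,t,z) A^{c,a'}(t,z,w',u') + δ_{z,t} A'^{κ,a,a'}(u,w,w',t) P^{0}(u'−t,u'−t)
+ B2pt^{κ,a,a'}(u,w,t,z,w',u') + X^{κ,a,a'}(u,w,t,z,w',u')`.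
[cite: FitznerVanDerHofstad2017, §5.1 (5.4) (arXiv:1506.07977v2 p. 48); §6.1 "Case a = 0 and b = 0" (p. 59)] -/
def blockBpt' (L : Letters d) (B2pt X : DirBlockFamilyPt d) : DirBlockFamilyPt d :=
  fun κ a a' u w t z w' u' =>
    (∑ c : Fin 3, blockAiotaSt' L κ a c u w t z * blockA L c a' t z w' u')
      + kd z t * (blockAiota' L κ a a' u w w' t * blockPS L 0 (u' - t) (u' - t))
      + B2pt κ a a' u w t z w' u' + X κ a a' u w t z w' u'

/-- **`B'^{ι,a,b}` with the base-`u` `B^{(2)}` piece plugged in** (extra summand `X₂`).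
[cite: FitznerVanDerHofstad2017, §5.1 (5.4) (arXiv:1506.07977v2 p. 48); App. B (p. 76)] -/
def blockBFull' (L : Letters d) (X₂ : DirBlockFamily d) : DirBlockFamily d := blockB' L (blockBNT' L) X₂

/-- **`B'^{ι,a,b}` pointwise with the base-`u` `B^{(2)}` piece plugged in** (extra summand `X`).
[cite: FitznerVanDerHofstad2017, §5.1 (5.4) (arXiv:1506.07977v2 p. 48); App. B (p. 76)] -/
def blockBFullpt' (L : Letters d) (X : DirBlockFamilyPt d) : DirBlockFamilyPt d := blockBpt' L (blockBNTpt' L) X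

/-- `(B')_{a,b} = sup_v Σ_{ι,x,y} B'^{ι,a,b}(0,v,x,y)` — the element of the primed middle block.
[cite: FitznerVanDerHofstad2017, §5.1 "Elements of the bounds" (arXiv:1506.07977v2 p. 49)] -/
def matBiotaFull' (L : Letters d) (X₂ : DirBlockFamily d) : Matrix (Fin 3) (Fin 3) ℝ≥0∞ := matB (blockBFull' L X₂)

/-! ### B. Algebra -/

section Algebra

variable (L : Letters d)

/-- Off entry class `0` the primed pointwise block is the landed one plus the extra summand.
[cite: FitznerVanDerHofstad2017, §5.1 (5.4) (arXiv:1506.07977v2 p. 48); App. B (p. 75)] -/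
theorem blockBpt'_of_ne (B2pt X : DirBlockFamilyPt d) {a : Fin 3} (ha : a ≠ 0) (κ : Fin d × Bool) (a' : Fin 3)
    (u w t z w' u' : Site d) :
    blockBpt' L B2pt X κ a a' u w t z w' u' = blockBpt L B2pt κ a a' u w t z w' u' + X κ a a' u w t z w' u' := by
  have h1 : ∀ c, blockAiotaSt' L κ a c = blockAiotaSt L κ a c := fun c => blockAiotaSt'_of_ne L κ (fun h => ha h.1)
  have h2 : blockAiota' L κ a a' = blockAiota L κ a a' := blockAiota'_of_ne L κ (fun h => ha h.1)
  simp only [blockBpt', blockBpt, h1, h2]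

/-- Off entry class `0` the primed block is the landed one plus the extra summand.
[cite: FitznerVanDerHofstad2017, §5.1 (5.4) (arXiv:1506.07977v2 p. 48); App. B (p. 75)] -/
theorem blockB'_of_ne (B2 X₂ : DirBlockFamily d) (ι : Fin d × Bool) {a : Fin 3} (ha : a ≠ 0) (b : Fin 3)
    (u v x y : Site d) :
    blockB' L B2 X₂ ι a b u v x y = blockB L B2 ι a b u v x y + X₂ ι a b u v x y := by
  have h1 : ∀ c, blockAiotaSt' L ι a c = blockAiotaSt L ι a c := fun c => blockAiotaSt'_of_ne L ι (fun h => ha h.1)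
  have h2 : blockAiota' L ι a b = blockAiota L ι a b := blockAiota'_of_ne L ι (fun h => ha h.1)
  simp only [blockB', blockB, h1, h2]

/-- The extra summand splits off: `blockBpt' L B2pt X = blockBpt' L B2pt 0 + X` pointwise.
[cite: FitznerVanDerHofstad2017, §5.1 (5.4) (arXiv:1506.07977v2 p. 48)] -/
theorem blockBpt'_eq_add_X (B2pt X : DirBlockFamilyPt d) (κ : Fin d × Bool) (a a' : Fin 3)
    (u w t z w' u' : Site d) :
    blockBpt' L B2pt X κ a a' u w t z w' u' = blockBpt' L B2pt 0 κ a a' u w t z w' u' + X κ a a' u w t z w' u' := by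
  simp only [blockBpt', Pi.zero_apply, add_zero]

/-- Off entry class `0`, with no extra summand, the primed pointwise block with the base-`u` `B^{(2)}` piece is the
landed pointwise (5.4) with that piece. [cite: FitznerVanDerHofstad2017, §5.1 (5.4) (arXiv:1506.07977v2 p. 48); App. B (pp. 75–76)] -/
theorem blockBFullpt'_zero_of_ne {a : Fin 3} (ha : a ≠ 0) (κ : Fin d × Bool) (a' : Fin 3) (u w t z w' u' : Site d) :
    blockBFullpt' L 0 κ a a' u w t z w' u' = blockBpt L (blockBNTpt' L) κ a a' u w t z w' u' := by
  simp only [blockBFullpt', blockBpt'_of_ne L _ _ ha, Pi.zero_apply, add_zero]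

/-- Off entry class `0`, with no extra summand, `blockBFull' L 0` is the landed (5.4) with the base-`u` `B^{(2)}`
piece. [cite: FitznerVanDerHofstad2017, §5.1 (5.4) (arXiv:1506.07977v2 p. 48); App. B (pp. 75–76)] -/
theorem blockBFull'_zero_of_ne (ι : Fin d × Bool) {a : Fin 3} (ha : a ≠ 0) (b : Fin 3) (u v x y : Site d) :
    blockBFull' L 0 ι a b u v x y = blockB L (blockBNT' L) ι a b u v x y := by
  simp only [blockBFull', blockB'_of_ne L _ _ ι ha, Pi.zero_apply, add_zero]

/-- **Summing the internal pair of the primed pointwise (5.4) gives the primed (5.4)**: if `Σ_{t,z} B2pt = B2`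
and `Σ_{t,z} X = X₂` then `Σ_{t,z} blockBpt' L B2pt X κ a a' u w t z w' u' = blockB' L B2 X₂ κ a a' u w w' u'`.
[cite: FitznerVanDerHofstad2017, §5.1 (5.4) (arXiv:1506.07977v2 p. 48)] -/
theorem tsum_tsum_blockBpt' (B2pt X : DirBlockFamilyPt d) (B2 X₂ : DirBlockFamily d)
    (hB2 : ∀ κ a a' u w w' u', ∑' t, ∑' z, B2pt κ a a' u w t z w' u' = B2 κ a a' u w w' u')
    (hX : ∀ κ a a' u w w' u', ∑' t, ∑' z, X κ a a' u w t z w' u' = X₂ κ a a' u w w' u')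
    (κ : Fin d × Bool) (a a' : Fin 3) (u w w' u' : Site d) :
    ∑' t, ∑' z, blockBpt' L B2pt X κ a a' u w t z w' u' = blockB' L B2 X₂ κ a a' u w w' u' := by
  have h1 : ∑' t, ∑' z, ∑ c : Fin 3, blockAiotaSt' L κ a c u w t z * blockA L c a' t z w' u' =
      ∑ c : Fin 3, comp (blockAiotaSt' L κ a c) (blockA L c a') u w w' u' := by
    simp only [comp]; simp_rw [tsum_finsetSum]
  have h2 : ∑' t, ∑' z, kd z t * (blockAiota' L κ a a' u w w' t * blockPS L 0 (u' - t) (u' - t)) =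
      ∑' t, blockAiota' L κ a a' u w w' t * blockPS L 0 (u' - t) (u' - t) :=
    tsum_congr fun t => tsum_kd_mul_const t _
  simp only [blockBpt', blockB', ENNReal.tsum_add, hB2, hX, h1, h2]

/-- **`Σ_{t,z} blockBFullpt' L X = blockBFull' L X₂`** when `Σ_{t,z} X = X₂`.
[cite: FitznerVanDerHofstad2017, §5.1 (5.4) (arXiv:1506.07977v2 p. 48); App. B (p. 76)] -/
theorem tsum_tsum_blockBFullpt' (X : DirBlockFamilyPt d) (X₂ : DirBlockFamily d)
    (hX : ∀ κ a a' u w w' u', ∑' t, ∑' z, X κ a a' u w t z w' u' = X₂ κ a a' u w w' u')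
    (κ : Fin d × Bool) (a a' : Fin 3) (u w w' u' : Site d) :
    ∑' t, ∑' z, blockBFullpt' L X κ a a' u w t z w' u' = blockBFull' L X₂ κ a a' u w w' u' :=
  tsum_tsum_blockBpt' L (blockBNTpt' L) X (blockBNT' L) X₂ (tsum_tsum_blockBNTpt' L) hX κ a a' u w w' u'

/-- **The block-summation hypothesis `hBpt` for the primed pair** `B := blockBFull' L X₂`, `Bpt := blockBFullpt' L X`
(with equality). [cite: FitznerVanDerHofstad2017, §5.1 (5.4) (arXiv:1506.07977v2 p. 48); §6.2.1 (6.49)–(6.51) (pp. 65–67)] -/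
theorem blockBFullpt'_hBpt (X : DirBlockFamilyPt d) (X₂ : DirBlockFamily d)
    (hX : ∀ κ a a' u w w' u', ∑' t, ∑' z, X κ a a' u w t z w' u' = X₂ κ a a' u w w' u') :
    ∀ κ a a' (u w w' u' : Site d),
      ∑' t, ∑' z, blockBFullpt' L X κ a a' u w t z w' u' ≤ blockBFull' L X₂ κ a a' u w w' u' :=
  fun κ a a' u w w' u' => (tsum_tsum_blockBFullpt' L X X₂ hX κ a a' u w w' u').le

/-- The `X = 0` case: `Σ_{t,z} blockBFullpt' L 0 = blockBFull' L 0`.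
[cite: FitznerVanDerHofstad2017, §5.1 (5.4) (arXiv:1506.07977v2 p. 48); App. B (p. 76)] -/
theorem tsum_tsum_blockBFullpt'_zero (κ : Fin d × Bool) (a a' : Fin 3) (u w w' u' : Site d) :
    ∑' t, ∑' z, blockBFullpt' L 0 κ a a' u w t z w' u' = blockBFull' L 0 κ a a' u w w' u' :=
  tsum_tsum_blockBFullpt' L 0 0 (fun _ _ _ _ _ _ _ => by simp) κ a a' u w w' u'

/-- The `X = 0` case of `blockBFullpt'_hBpt`. [cite: FitznerVanDerHofstad2017, §5.1 (5.4) (arXiv:1506.07977v2 p. 48); §6.2.1 (6.49)–(6.51) (pp. 65–67)] -/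
theorem blockBFullpt'_hBpt_zero :
    ∀ κ a a' (u w w' u' : Site d),
      ∑' t, ∑' z, blockBFullpt' L 0 κ a a' u w t z w' u' ≤ blockBFull' L 0 κ a a' u w w' u' :=
  blockBFullpt'_hBpt L 0 0 (fun _ _ _ _ _ _ _ => by simp)

end Algebra

/-! ### C. Translation invariance -/

section TransInv

variable (L : Letters d)

/-- The base-`u` pointwise `B^{(2)}` piece is translation invariant in all six vertices.
[cite: FitznerVanDerHofstad2017, §5.1 (5.4) and "Elements of the bounds" (translation invariance used in the sup over the base point) (arXiv:1506.07977v2 pp. 48–49); §3.5 (p. 32)] -/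
theorem isTransInv₆_blockBNTpt' (κ : Fin d × Bool) (a a' : Fin 3) : IsTransInv₆ (blockBNTpt' L κ a a') :=
  fun g u w t z x y => by simp only [blockBNTpt', add_sub_add_right_eq_sub]

/-- The primed pointwise block is translation invariant in all six vertices whenever its parameters are.
[cite: FitznerVanDerHofstad2017, §5.1 (5.4) and "Elements of the bounds" (translation invariance used in the sup over the base point) (arXiv:1506.07977v2 pp. 48–49); §3.5 (p. 32)] -/
theorem isTransInv₆_blockBpt' {B2pt X : DirBlockFamilyPt d} (hB2 : ∀ κ a a', IsTransInv₆ (B2pt κ a a'))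
    (hX : ∀ κ a a', IsTransInv₆ (X κ a a')) (κ : Fin d × Bool) (a a' : Fin 3) :
    IsTransInv₆ (blockBpt' L B2pt X κ a a') := fun g u w t z x y => by
  have hAst : ∀ c, blockAiotaSt' L κ a c (u + g) (w + g) (t + g) (z + g) = blockAiotaSt' L κ a c u w t z :=
    fun c => isTransInv_blockAiotaSt' L κ a c g u w t z
  have hA : ∀ c, blockA L c a' (t + g) (z + g) (x + g) (y + g) = blockA L c a' t z x y :=
    fun c => isTransInv_blockA L c a' g t z x y
  have hAi : blockAiota' L κ a a' (u + g) (w + g) (x + g) (t + g) = blockAiota' L κ a a' u w x t :=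
    isTransInv_blockAiota' L κ a a' g u w x t
  have hkd : kd (z + g) (t + g) = kd z t := by simp only [kd, add_left_inj]
  simp only [blockBpt', hAst, hA, hAi, hkd, add_sub_add_right_eq_sub, hB2 κ a a' g u w t z x y,
    hX κ a a' g u w t z x y]

/-- The zero family is translation invariant.
[cite: FitznerVanDerHofstad2017, §5.1 (5.4) and "Elements of the bounds" (translation invariance used in the sup over the base point) (arXiv:1506.07977v2 pp. 48–49); §3.5 (p. 32)] -/
theorem isTransInv₆_zero_familyPt (κ : Fin d × Bool) (a a' : Fin 3) :
    IsTransInv₆ ((0 : DirBlockFamilyPt d) κ a a') := fun _ _ _ _ _ _ _ => rfl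

/-- `blockBFullpt' L X` is translation invariant in all six vertices whenever `X` is.
[cite: FitznerVanDerHofstad2017, §5.1 (5.4) and "Elements of the bounds" (translation invariance used in the sup over the base point) (arXiv:1506.07977v2 pp. 48–49); §3.5 (p. 32)] -/
theorem isTransInv₆_blockBFullpt' {X : DirBlockFamilyPt d} (hX : ∀ κ a a', IsTransInv₆ (X κ a a'))
    (κ : Fin d × Bool) (a a' : Fin 3) : IsTransInv₆ (blockBFullpt' L X κ a a') :=
  isTransInv₆_blockBpt' L (isTransInv₆_blockBNTpt' L) hX κ a a'

/-- `blockBFullpt' L 0` is translation invariant in all six vertices.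
[cite: FitznerVanDerHofstad2017, §5.1 (5.4) and "Elements of the bounds" (translation invariance used in the sup over the base point) (arXiv:1506.07977v2 pp. 48–49); §3.5 (p. 32)] -/
theorem isTransInv₆_blockBFullpt'_zero (κ : Fin d × Bool) (a a' : Fin 3) : IsTransInv₆ (blockBFullpt' L 0 κ a a') :=
  isTransInv₆_blockBFullpt' L isTransInv₆_zero_familyPt κ a a'

/-- `B'^{ι,a,b}` is translation invariant whenever `B2` and `X₂` are.
[cite: FitznerVanDerHofstad2017, §5.1 (5.4) and "Elements of the bounds" (translation invariance used in the sup over the base point) (arXiv:1506.07977v2 pp. 48–49); §3.5 (p. 32)] -/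
theorem isTransInv_blockB' {B2 X₂ : DirBlockFamily d} (hB2 : ∀ ι a b, IsTransInv (B2 ι a b))
    (hX₂ : ∀ ι a b, IsTransInv (X₂ ι a b)) (ι : Fin d × Bool) (a b : Fin 3) : IsTransInv (blockB' L B2 X₂ ι a b) := by
  have h1 : IsTransInv (fun u v x y => ∑ c : Fin 3, comp (blockAiotaSt' L ι a c) (blockA L c b) u v x y) :=
    IsTransInv.finsetSum Finset.univ fun c _ =>
      IsTransInv.comp (isTransInv_blockAiotaSt' L ι a c) (isTransInv_blockA L c b)
  have h2 : IsTransInv (fun u v x y => ∑' t, blockAiota' L ι a b u v x t * blockPS L 0 (y - t) (y - t)) :=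
    isTransInv_compVertex (isTransInv_blockAiota' L ι a b) (fun z => blockPS L 0 z z)
  exact isTransInv_add (isTransInv_add (isTransInv_add h1 h2) (hB2 ι a b)) (hX₂ ι a b)

/-- `blockBFull' L X₂` is translation invariant whenever `X₂` is.
[cite: FitznerVanDerHofstad2017, §5.1 (5.4) and "Elements of the bounds" (translation invariance used in the sup over the base point) (arXiv:1506.07977v2 pp. 48–49); §3.5 (p. 32)] -/
theorem isTransInv_blockBFull' {X₂ : DirBlockFamily d} (hX₂ : ∀ ι a b, IsTransInv (X₂ ι a b)) (ι : Fin d × Bool)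
    (a b : Fin 3) : IsTransInv (blockBFull' L X₂ ι a b) :=
  isTransInv_blockB' L (fun ι a b => isTransInv_blockBNT' L ι a b) hX₂ ι a b

/-- `blockBFull' L 0` is translation invariant.
[cite: FitznerVanDerHofstad2017, §5.1 (5.4) and "Elements of the bounds" (translation invariance used in the sup over the base point) (arXiv:1506.07977v2 pp. 48–49); §3.5 (p. 32)] -/
theorem isTransInv_blockBFull'_zero (ι : Fin d × Bool) (a b : Fin 3) : IsTransInv (blockBFull' L 0 ι a b) :=
  isTransInv_blockBFull' L (fun _ _ _ _ _ _ _ _ => rfl) ι a b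

end TransInv

/-! ### D. Bond percolation: `W_d`-covariance of the primed pointwise block -/

section SignedPerm

variable (p : unitInterval) (π : Equiv.Perm (Fin d)) (ε : Fin d → ℤˣ) {ρ : Fin d × Bool → Fin d × Bool}

/-- **Base-`u` `B^{(2)}` summand covariance**: `blockBNTpt₀' 𝐋 (ρκ) a b (σ·) = blockBNTpt₀' 𝐋 κ a b (·)` when
`σ e_κ = e_{ρκ}`. [cite: FitznerVanDerHofstad2017, App. B Table "Diagrams and definition of B^{(2),ι,a,b}(0,v,x,y)" (arXiv:1506.07977v2 p. 76); §3.5 (p. 32)] -/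
theorem perc_blockBNTpt₀'_signedPerm (hρ : ∀ κ, Site.signedPerm π ε (𝐞 κ) = 𝐞 (ρ κ)) (κ : Fin d × Bool)
    (a b : Fin 3) (v x y t z : Site d) :
    blockBNTpt₀' (Letters.perc d p) (ρ κ) a b (Site.signedPerm π ε v) (Site.signedPerm π ε x) (Site.signedPerm π ε y)
      (Site.signedPerm π ε t) (Site.signedPerm π ε z) = blockBNTpt₀' (Letters.perc d p) κ a b v x y t z := by
  fin_cases a <;> fin_cases b <;>
    simp only [blockBNTpt₀', ← hρ, kd_signedPerm_zero, kdc_signedPerm, ← signedPerm_sub, ← signedPerm_neg,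
      twoDD_signedPerm, perc_S_signedPerm, perc_T_signedPerm_zero, perc_P_signedPerm, perc_P_signedPerm_zero,
      perc_B_signedPerm]

/-- `blockBNTpt' 𝐋 (ρκ) a a' (σ·) = blockBNTpt' 𝐋 κ a a' (·)`. [cite: FitznerVanDerHofstad2017, App. B (arXiv:1506.07977v2 p. 76); §3.5 (p. 32)] -/
theorem perc_blockBNTpt'_signedPerm (hρ : ∀ κ, Site.signedPerm π ε (𝐞 κ) = 𝐞 (ρ κ)) (κ : Fin d × Bool)
    (a a' : Fin 3) (u w t z w' u' : Site d) :
    blockBNTpt' (Letters.perc d p) (ρ κ) a a' (Site.signedPerm π ε u) (Site.signedPerm π ε w) (Site.signedPerm π ε t)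
      (Site.signedPerm π ε z) (Site.signedPerm π ε w') (Site.signedPerm π ε u') =
      blockBNTpt' (Letters.perc d p) κ a a' u w t z w' u' := by
  simp only [blockBNTpt', ← signedPerm_sub, perc_blockBNTpt₀'_signedPerm p π ε hρ]

/-- **Primed pointwise (5.4) covariance** for covariant parameters `B2pt`, `X`.
[cite: FitznerVanDerHofstad2017, §5.1 (5.4) (arXiv:1506.07977v2 p. 48); §6.1 p. 59; §3.5 (p. 32)] -/
theorem perc_blockBpt'_signedPerm {B2pt X : DirBlockFamilyPt d}
    (hρ : ∀ κ, Site.signedPerm π ε (𝐞 κ) = 𝐞 (ρ κ))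
    (hB2 : ∀ κ a b u w t z w' u', B2pt (ρ κ) a b (Site.signedPerm π ε u) (Site.signedPerm π ε w)
      (Site.signedPerm π ε t) (Site.signedPerm π ε z) (Site.signedPerm π ε w') (Site.signedPerm π ε u') =
      B2pt κ a b u w t z w' u')
    (hX : ∀ κ a b u w t z w' u', X (ρ κ) a b (Site.signedPerm π ε u) (Site.signedPerm π ε w)
      (Site.signedPerm π ε t) (Site.signedPerm π ε z) (Site.signedPerm π ε w') (Site.signedPerm π ε u') =
      X κ a b u w t z w' u')
    (κ : Fin d × Bool) (a b : Fin 3) (u w t z w' u' : Site d) :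
    blockBpt' (Letters.perc d p) B2pt X (ρ κ) a b (Site.signedPerm π ε u) (Site.signedPerm π ε w)
      (Site.signedPerm π ε t) (Site.signedPerm π ε z) (Site.signedPerm π ε w') (Site.signedPerm π ε u') =
      blockBpt' (Letters.perc d p) B2pt X κ a b u w t z w' u' := by
  simp only [blockBpt', perc_blockAiotaSt'_signedPerm p π ε hρ, perc_blockA_signedPerm p π ε, kd_signedPerm,
    perc_blockAiota'_signedPerm p π ε hρ, ← signedPerm_sub, perc_blockPS_signedPerm, hB2, hX]

/-- **`blockBFullpt' 𝐋 X (ρκ) a b (σ·) = blockBFullpt' 𝐋 X κ a b (·)`** for a covariant extra summand `X`.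
[cite: FitznerVanDerHofstad2017, §5.1 (5.4) (arXiv:1506.07977v2 p. 48); App. B (p. 76); §3.5 (p. 32)] -/
theorem perc_blockBFullpt'_signedPerm {X : DirBlockFamilyPt d} (hρ : ∀ κ, Site.signedPerm π ε (𝐞 κ) = 𝐞 (ρ κ))
    (hX : ∀ κ a b u w t z w' u', X (ρ κ) a b (Site.signedPerm π ε u) (Site.signedPerm π ε w)
      (Site.signedPerm π ε t) (Site.signedPerm π ε z) (Site.signedPerm π ε w') (Site.signedPerm π ε u') =
      X κ a b u w t z w' u')
    (κ : Fin d × Bool) (a b : Fin 3) (u w t z w' u' : Site d) :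
    blockBFullpt' (Letters.perc d p) X (ρ κ) a b (Site.signedPerm π ε u) (Site.signedPerm π ε w)
      (Site.signedPerm π ε t) (Site.signedPerm π ε z) (Site.signedPerm π ε w') (Site.signedPerm π ε u') =
      blockBFullpt' (Letters.perc d p) X κ a b u w t z w' u' :=
  perc_blockBpt'_signedPerm p π ε hρ (perc_blockBNTpt'_signedPerm p π ε hρ) hX κ a b u w t z w' u'

/-- **`Σ_κ blockBFullpt' 𝐋 X κ a b (σ·) = Σ_κ blockBFullpt' 𝐋 X κ a b (·)`** for an extra summand `X` covariant
under every direction relabelling. [cite: FitznerVanDerHofstad2017, §5.1 (5.4) (arXiv:1506.07977v2 p. 48); §6.1 p. 59; §3.5 (p. 32)] -/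
theorem sum_perc_blockBFullpt'_signedPerm {X : DirBlockFamilyPt d}
    (hX : ∀ ρ : Fin d × Bool → Fin d × Bool, (∀ κ, Site.signedPerm π ε (𝐞 κ) = 𝐞 (ρ κ)) →
      ∀ κ a b u w t z w' u', X (ρ κ) a b (Site.signedPerm π ε u) (Site.signedPerm π ε w)
        (Site.signedPerm π ε t) (Site.signedPerm π ε z) (Site.signedPerm π ε w') (Site.signedPerm π ε u') =
        X κ a b u w t z w' u')
    (a b : Fin 3) (u w t z w' u' : Site d) :
    ∑ κ, blockBFullpt' (Letters.perc d p) X κ a b (Site.signedPerm π ε u) (Site.signedPerm π ε w)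
        (Site.signedPerm π ε t) (Site.signedPerm π ε z) (Site.signedPerm π ε w') (Site.signedPerm π ε u') =
      ∑ κ, blockBFullpt' (Letters.perc d p) X κ a b u w t z w' u' := by
  obtain ⟨σ, hσ⟩ := exists_stepVec_perm π ε
  rw [← Equiv.sum_comp σ (fun κ => blockBFullpt' (Letters.perc d p) X κ a b (Site.signedPerm π ε u)
    (Site.signedPerm π ε w) (Site.signedPerm π ε t) (Site.signedPerm π ε z) (Site.signedPerm π ε w')
    (Site.signedPerm π ε u'))]
  exact Finset.sum_congr rfl fun κ _ => perc_blockBFullpt'_signedPerm p π ε hσ (hX σ hσ) κ a b u w t z w' u'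

/-- The `X = 0` case: `Σ_κ blockBFullpt' 𝐋 0 κ a b (σ·) = Σ_κ blockBFullpt' 𝐋 0 κ a b (·)`.
[cite: FitznerVanDerHofstad2017, §5.1 (5.4) (arXiv:1506.07977v2 p. 48); §6.1 p. 59; §3.5 (p. 32)] -/
theorem sum_perc_blockBFullpt'_zero_signedPerm (a b : Fin 3) (u w t z w' u' : Site d) :
    ∑ κ, blockBFullpt' (Letters.perc d p) 0 κ a b (Site.signedPerm π ε u) (Site.signedPerm π ε w)
        (Site.signedPerm π ε t) (Site.signedPerm π ε z) (Site.signedPerm π ε w') (Site.signedPerm π ε u') =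
      ∑ κ, blockBFullpt' (Letters.perc d p) 0 κ a b u w t z w' u' :=
  sum_perc_blockBFullpt'_signedPerm p π ε (fun _ _ _ _ _ _ _ _ _ _ _ => rfl) a b u w t z w' u'

end SignedPerm

/-- **`Σ_κ blockBFullpt' 𝐋 X κ a b` is `W_d`-covariant in all six vertices** for an extra summand covariant under
every lattice symmetry with its direction relabelling (hypothesis `hBpt` of `isCov₄_sum_secEo` /
`isCov₃_sum_secEc` / `isCov₃_sum_secEoc` for the primed block).
[cite: FitznerVanDerHofstad2017, §5.1 (5.4) (arXiv:1506.07977v2 p. 48); §6.1 p. 59; §3.5 (p. 32)] -/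
theorem isCov₆_sum_perc_blockBFullpt' (p : unitInterval) {X : DirBlockFamilyPt d}
    (hX : ∀ (π : Equiv.Perm (Fin d)) (ε : Fin d → ℤˣ) (ρ : Fin d × Bool → Fin d × Bool),
      (∀ κ, Site.signedPerm π ε (𝐞 κ) = 𝐞 (ρ κ)) →
      ∀ κ a b u w t z w' u', X (ρ κ) a b (Site.signedPerm π ε u) (Site.signedPerm π ε w)
        (Site.signedPerm π ε t) (Site.signedPerm π ε z) (Site.signedPerm π ε w') (Site.signedPerm π ε u') =
        X κ a b u w t z w' u')
    (a b : Fin 3) :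
    IsCov₆ (signedPermAddEquivs d) (fun u w t z w' u' => ∑ κ, blockBFullpt' (Letters.perc d p) X κ a b u w t z w' u') := by
  rintro φ ⟨⟨π, ε⟩, rfl⟩ u w t z w' u'
  exact sum_perc_blockBFullpt'_signedPerm p π ε (hX π ε) a b u w t z w' u'

/-- **`Σ_κ blockBFullpt' 𝐋 0 κ a b` is `W_d`-covariant in all six vertices** (the `X = 0` case).
[cite: FitznerVanDerHofstad2017, §5.1 (5.4) (arXiv:1506.07977v2 p. 48); §6.1 p. 59; §3.5 (p. 32)] -/
theorem isCov₆_sum_perc_blockBFullpt'_zero (p : unitInterval) (a b : Fin 3) :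
    IsCov₆ (signedPermAddEquivs d) (fun u w t z w' u' => ∑ κ, blockBFullpt' (Letters.perc d p) 0 κ a b u w t z w' u') :=
  isCov₆_sum_perc_blockBFullpt' p (fun _ _ _ _ _ _ _ _ _ _ _ _ _ => rfl) a b

end Literature.Probability.FitznerVanDerHofstad2017.NobleBlocks

end
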